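import Literature.AlgebraicGeometry.Motives.LangWeilEstimateOfRiemannHypothesis
import Literature.AlgebraicGeometry.Motives.VarietiesQuasiCompactProofs
import Literature.NumberTheory.LFunctions.WeilFactorizationClosedPointEstimate
import Literature.NumberTheory.LFunctions.WeilFactorizationClosedPointsOfCurves
import HarnessLib

/-!
# Closed points of a smooth projective variety for a Galois Weil cohomology theory with the Riemann
# hypothesis: `|m · a_m − q^{dm}| ≤ (5 + 3 Σ_{0<i<2d} bᵢ) q^{m(d−1/2)}`, closed points of every large degree,
# `a_m ∼ q^{dm}/m`; curves: places of every degree `≥ 4g + 3`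

Topic `Literature/AlgebraicGeometry/Motives`; THEOREMS ONLY (no definition, no instance, no named
fact; D-0026).  The E-LEVEL reading of `LFunctions/WeilFactorizationClosedPointEstimate` and
`LFunctions/WeilFactorizationClosedPointsOfCurves` (rows g46-#3/#4), exactly as
`Motives/LangWeilEstimateOfRiemannHypothesis` (row g41-#3) reads `LFunctions/WeilFactorizationPointCountEstimate`:
for the tree's abstract Galois Weil cohomology theory `E : GaloisWeilCohomology k K χ` over a finite field
`k` (`q = #k`) satisfying the Lefschetz trace formula and `χ(φ) = q`, and `X` smooth projective of
dimension `d ≥ 1` satisfying `E.WeilRiemannHypothesisFor X d`, the zeta function has the Weil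
factorisation `isWeilFactorization_of_isIntegralModel` with `deg Pᵢ = bᵢ = dim_K Hⁱ(X)`, and the
closed-point counts `a_m = closedPointCount X m` (Frobenius orbits of geometric points of degree `m`,
`Motives/ClosedPointsOfDegree`) obey the prime number theorem.

Printed sources (curves, `d = 1`, `b₁ = 2g`), read on the page: M. Rosen, *Number Theory in Function
Fields* [RosenFunctionFields2002], Thm. 5.12 «`a_N = #{P | deg(P) = N} = q^N/N + O(q^{N/2}/N)`»;
H. Stichtenoth, *Algebraic Function Fields and Codes* [Stichtenoth2009], Cor. 5.2.10 «(a) `|B_r − q^r/r|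
… < (2+7g) · q^{r/2}/r` … (c) … if `r ≥ 4g+3` then `B_r ≥ 1`»; the dimension-`d` point-count input is
Lang–Weil [LangWeil1954] Th. 1 / Deligne [Deligne1974] Th. (1.6) (the tree's
`abs_pointCount_sub_le_mul_rpow_of_weilRiemannHypothesis`).

* §1 (dimension `d ≥ 1`) **`abs_mul_closedPointCount_sub_pow_le_of_weilRiemannHypothesis`**:
  `|m · a_m − q^{dm}| ≤ (5 + 3 Σ_{0<i<2d} bᵢ) · q^{m(d−1/2)}`;
  **`exists_forall_closedPointCount_pos_of_weilRiemannHypothesis`** (closed points of every sufficiently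
  large degree); **`tendsto_mul_closedPointCount_div_pow_of_weilRiemannHypothesis`** (`m a_m / q^{dm} → 1`).
* §2 (curves, `d = 1`, `b₁ = dim_K H¹(X)`) **`abs_closedPointCount_sub_div_lt_of_weilRiemannHypothesis`**
  (`|a_r − q^r/r| < (2 + 7b₁/2) q^{r/2}/r`, `r ≥ 2`; Stichtenoth Cor. 5.2.10 (a)),
  **`closedPointCount_pos_of_finrank_eq_two_mul_of_weilRiemannHypothesis`** (`b₁ = 2g`, `r ≥ 4g + 3 ⟹
  a_r ≥ 1`; Cor. 5.2.10 (c)), `closedPointCount_pos_of_finrank_eq_zero_of_weilRiemannHypothesis`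
  (`b₁ = 0 ⟹ a_r ≥ 1` for all `r ≥ 1`; Cor. 5.2.10 (b)).

All three hypotheses (trace formula, `χ(φ) = q`, RH) are theorems for `ℓ`-adic cohomology; for the
abstract `E` they are genuine hypotheses.  HC is not touched.

## References

* [RosenFunctionFields2002] M. Rosen, GTM 210 (2002), Thm. 5.12.
* [Stichtenoth2009] H. Stichtenoth, GTM 254 (2009), Cor. 5.2.10.
* [LangWeil1954] S. Lang, A. Weil, Amer. J. Math. 76 (1954), Th. 1.
* [Deligne1974] P. Deligne, *La conjecture de Weil. I*, Publ. Math. IHÉS 43 (1974), Th. (1.6).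
* [Poonen2017] B. Poonen, *Rational points on varieties*, GSM 186 (2017), Th. 7.7.1.

## Provenance

Lane `lit-hodgefound` (summit `HodgeConjecture`, Track 2 foundations library, Layer B: motives /
zeta functions), seat `lit-hodgefound-p29` (literature-prover, generation 46, row g46-#5).
-/

noncomputable section

open Polynomial Filter AlgebraicGeometry

universe u v

namespace Literature.AlgebraicGeometry.Motives

namespace GaloisWeilCohomology

open Literature.NumberTheory.LFunctions (isWeilFactorization_of_isIntegralModel)

variable {k : Type u} [Field k] [Finite k] {K : Type v} [Field K] [CharZero K]
  {χ : Field.absoluteGaloisGroup k →* Kˣ} (E : GaloisWeilCohomology k K χ)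
variable {d : ℕ} {X : SchemeOver k}

/-! ### Re-indexing helpers -/

/-- A sum over `Fin N` filtered by a predicate of the value is the corresponding sum over `range N`.
[folklore] -/
private theorem sum_univ_filter_eq_sum_range_filter' {M : Type*} [AddCommMonoid M] (N : ℕ)
    (p : ℕ → Prop) [DecidablePred p] (g : ℕ → M) :
    ∑ i ∈ (Finset.univ : Finset (Fin N)) with p i.val, g i.val =
      ∑ i ∈ (Finset.range N) with p i, g i := by
  rw [Finset.sum_filter, Finset.sum_filter]
  exact Fin.sum_univ_eq_sum_range (fun i => if p i then g i else 0) N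

/-- The middle indices `0 < i < 2d` of a Weil factorisation, re-indexed by `ℕ` (copy of the private
helper of `LangWeilEstimateOfRiemannHypothesis`). [folklore] -/
private theorem sum_filter_middle_eq_sum_Ioo' {M : Type*} [AddCommMonoid M] (d : ℕ) (g : ℕ → M) :
    ∑ i ∈ (Finset.univ : Finset (Fin (2 * d + 1))) with (i ≠ 0 ∧ i ≠ Fin.last (2 * d)), g i.val =
      ∑ i ∈ Finset.Ioo 0 (2 * d), g i := by
  have h1 : (Finset.univ : Finset (Fin (2 * d + 1))).filter (fun i => i ≠ 0 ∧ i ≠ Fin.last (2 * d)) =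
      (Finset.univ : Finset (Fin (2 * d + 1))).filter (fun i => i.val ≠ 0 ∧ i.val ≠ 2 * d) := by
    ext i
    simp only [Finset.mem_filter, Finset.mem_univ, true_and, ne_eq, Fin.ext_iff, Fin.val_zero,
      Fin.val_last]
  have h2 : (Finset.range (2 * d + 1)).filter (fun i => i ≠ 0 ∧ i ≠ 2 * d) = Finset.Ioo 0 (2 * d) := by
    ext i
    simp only [Finset.mem_filter, Finset.mem_range, Finset.mem_Ioo]
    omega
  rw [h1, sum_univ_filter_eq_sum_range_filter' (2 * d + 1) (fun i => i ≠ 0 ∧ i ≠ 2 * d) g, h2]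

variable {E}

/-- From an `E`-integral Weil factorisation, `deg Pᵢ = bᵢ`. [folklore] -/
private theorem natDegree_eq_finrank' (hX : IsSmoothProjective d X) {P : Fin (2 * d + 1) → ℤ[X]}
    (hP : ∀ i : Fin (2 * d + 1), E.IsIntegralModel X i (P i)) (i : Fin (2 * d + 1)) :
    ((P i).natDegree : ℝ) = Module.finrank K (E.obj X i) := by
  rw [← E.finrank_eq_natDegree_of_isIntegralModel hX (hP i)]

omit [Finite k] in
/-- A smooth projective variety is locally of finite type over `k` (smooth ⟹ locally of finite
presentation). [folklore] -/
private theorem locallyOfFiniteType_of_isSmoothProjective (hX : IsSmoothProjective d X) :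
    LocallyOfFiniteType X.hom := by
  have := hX.smoothOfRelativeDimension
  have : Smooth X.hom := SmoothOfRelativeDimension.smooth d X.hom
  infer_instance

variable (E)

/-! ### §1 Dimension `d`: the prime number theorem for closed points -/

section PNT

/-- **`|m · a_m − q^{dm}| ≤ (5 + 3 Σ_{0<i<2d} bᵢ) · q^{m(d−1/2)}`** for every `m ≥ 1`, for `E` with the
Lefschetz trace formula and `χ(φ) = q`, `X` smooth projective of dimension `d ≥ 1` with
`E.WeilRiemannHypothesisFor X d`, `bᵢ = dim_K Hⁱ(X)`, `a_m` the number of closed points of degree `m` —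
Rosen Thm. 5.12 «`N a_N = q^N + O(q^{N/2})`» / Stichtenoth Cor. 5.2.10 (a) (curves), run in dimension `d`
through the Weil factorisation of `Z(X, T)` (`isWeilFactorization_of_isIntegralModel`) and row g46-#3.
[cite: RosenFunctionFields2002, Thm. 5.12] [cite: Stichtenoth2009, Cor. 5.2.10 (a)] [cite: LangWeil1954, Th. 1] [cite: Deligne1974, Th. (1.6)] -/
theorem abs_mul_closedPointCount_sub_pow_le_of_weilRiemannHypothesis (hE : E.HasLefschetzTraceFormula)
    (hχ : ((χ (arithFrob k) : Kˣ) : K) = Nat.card k) (hX : IsSmoothProjective d X) (hd : 1 ≤ d)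
    (hRH : E.WeilRiemannHypothesisFor X d) {m : ℕ} (hm : 0 < m) :
    |(m : ℝ) * closedPointCount X m - (Nat.card k : ℝ) ^ (d * m)| ≤
      (5 + 3 * ∑ i ∈ Finset.Ioo 0 (2 * d), (Module.finrank K (E.obj X i) : ℝ)) *
        (Nat.card k : ℝ) ^ (((d : ℝ) - 1 / 2) * m) := by
  haveI := locallyOfFiniteType_of_isSmoothProjective hX
  haveI : QuasiCompact X.hom := IsSmoothProjective.quasiCompact_holds hX
  obtain ⟨P, hP, hroots⟩ := hRH
  have hW := isWeilFactorization_of_isIntegralModel E hE hχ hX hP hroots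
  have h := Literature.NumberTheory.LFunctions.abs_mul_closedPointCount_sub_pow_le hd hW hm
  rw [Finset.sum_congr rfl fun i _ => natDegree_eq_finrank' hX hP i,
    sum_filter_middle_eq_sum_Ioo' d (fun i => (Module.finrank K (E.obj X i) : ℝ))] at h
  exact h

/-- **Closed points of every sufficiently large degree**: under the same hypotheses there is `m₀` with
`a_m ≥ 1` for every `m ≥ m₀` (Stichtenoth Cor. 5.2.10 (c) for curves: «if `r ≥ 4g+3` then `B_r ≥ 1`»).
[cite: Stichtenoth2009, Cor. 5.2.10 (c)] [cite: RosenFunctionFields2002, Thm. 5.12] -/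
theorem exists_forall_closedPointCount_pos_of_weilRiemannHypothesis (hE : E.HasLefschetzTraceFormula)
    (hχ : ((χ (arithFrob k) : Kˣ) : K) = Nat.card k) (hX : IsSmoothProjective d X) (hd : 1 ≤ d)
    (hRH : E.WeilRiemannHypothesisFor X d) : ∃ m₀ : ℕ, ∀ m, m₀ ≤ m → 0 < closedPointCount X m := by
  haveI := locallyOfFiniteType_of_isSmoothProjective hX
  haveI : QuasiCompact X.hom := IsSmoothProjective.quasiCompact_holds hX
  obtain ⟨P, hP, hroots⟩ := hRH
  exact Literature.NumberTheory.LFunctions.exists_forall_closedPointCount_pos hd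
    (isWeilFactorization_of_isIntegralModel E hE hχ hX hP hroots)

/-- **`a_m ∼ q^{dm}/m`: `m · a_m / q^{dm} → 1`** under the same hypotheses — the prime number theorem for
the closed points of `X` (Rosen Thm. 5.12 «`a_N = q^N/N + O(q^{N/2}/N)`» for curves).
[cite: RosenFunctionFields2002, Thm. 5.12] [cite: Stichtenoth2009, Cor. 5.2.10 (a)] -/
theorem tendsto_mul_closedPointCount_div_pow_of_weilRiemannHypothesis (hE : E.HasLefschetzTraceFormula)
    (hχ : ((χ (arithFrob k) : Kˣ) : K) = Nat.card k) (hX : IsSmoothProjective d X) (hd : 1 ≤ d)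
    (hRH : E.WeilRiemannHypothesisFor X d) :
    Tendsto (fun m : ℕ => (m : ℝ) * closedPointCount X m / (Nat.card k : ℝ) ^ (d * m))
      atTop (nhds 1) := by
  haveI := locallyOfFiniteType_of_isSmoothProjective hX
  haveI : QuasiCompact X.hom := IsSmoothProjective.quasiCompact_holds hX
  obtain ⟨P, hP, hroots⟩ := hRH
  exact Literature.NumberTheory.LFunctions.tendsto_mul_closedPointCount_div_pow hd
    (isWeilFactorization_of_isIntegralModel E hE hχ hX hP hroots)

end PNT

/-! ### §2 Curves: Stichtenoth Cor. 5.2.10 with `2g = b₁` -/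

section Curves

/-- From an `E`-integral Weil factorisation in dimension `1`, `deg P₁ = b₁`. [folklore] -/
private theorem natDegree_one_eq_finrank (hX : IsSmoothProjective 1 X) {P : Fin (2 * 1 + 1) → ℤ[X]}
    (hP : ∀ i : Fin (2 * 1 + 1), E.IsIntegralModel X i (P i)) :
    (P 1).natDegree = (haveI := E.finite_obj hX 1; Module.finrank K (E.obj X 1)) := by
  have h := E.finrank_eq_natDegree_of_isIntegralModel hX (hP 1)
  exact h.symm

/-- **Stichtenoth Cor. 5.2.10 (a) at E-level: `|a_r − q^r/r| < (2 + 7b₁/2) · q^{r/2}/r` for `r ≥ 2`**, for a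
smooth projective curve `X` (`d = 1`, `b₁ = dim_K H¹(X) = 2g`) under the trace formula, `χ(φ) = q` and RH
(printed «`< (2+7g) · q^{r/2}/r`»). [cite: Stichtenoth2009, Cor. 5.2.10 (a)] -/
theorem abs_closedPointCount_sub_div_lt_of_weilRiemannHypothesis (hE : E.HasLefschetzTraceFormula)
    (hχ : ((χ (arithFrob k) : Kˣ) : K) = Nat.card k) (hX : IsSmoothProjective 1 X)
    (hRH : E.WeilRiemannHypothesisFor X 1) {r : ℕ} (hr : 2 ≤ r) :
    |(closedPointCount X r : ℝ) - (Nat.card k : ℝ) ^ r / r| <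
      (2 + 7 * (Module.finrank K (E.obj X 1) : ℝ) / 2) * Real.sqrt (Nat.card k) ^ r / r := by
  haveI := locallyOfFiniteType_of_isSmoothProjective hX
  haveI : QuasiCompact X.hom := IsSmoothProjective.quasiCompact_holds hX
  obtain ⟨P, hP, hroots⟩ := hRH
  have hW := isWeilFactorization_of_isIntegralModel E hE hχ hX hP hroots
  have h := Literature.NumberTheory.LFunctions.abs_closedPointCount_sub_div_lt hW hr
  rwa [natDegree_one_eq_finrank E hX hP] at h

/-- **Stichtenoth Cor. 5.2.10 (c) at E-level: a smooth projective curve with `b₁ = 2g` has a closed point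
of every degree `r ≥ 4g + 3`** (`a_r ≥ 1`), under the trace formula, `χ(φ) = q` and RH («if `r ≥ 4g+3`
then `B_r ≥ 1`»). [cite: Stichtenoth2009, Cor. 5.2.10 (c)] -/
theorem closedPointCount_pos_of_finrank_eq_two_mul_of_weilRiemannHypothesis
    (hE : E.HasLefschetzTraceFormula) (hχ : ((χ (arithFrob k) : Kˣ) : K) = Nat.card k)
    (hX : IsSmoothProjective 1 X) (hRH : E.WeilRiemannHypothesisFor X 1) {g : ℕ}
    (hb : (haveI := E.finite_obj hX 1; Module.finrank K (E.obj X 1)) = 2 * g) {r : ℕ}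
    (hr : 4 * g + 3 ≤ r) : 0 < closedPointCount X r := by
  haveI := locallyOfFiniteType_of_isSmoothProjective hX
  haveI : QuasiCompact X.hom := IsSmoothProjective.quasiCompact_holds hX
  obtain ⟨P, hP, hroots⟩ := hRH
  have hW := isWeilFactorization_of_isIntegralModel E hE hχ hX hP hroots
  refine Literature.NumberTheory.LFunctions.closedPointCount_pos_of_ge hW (g := g) ?_ hr
  rw [natDegree_one_eq_finrank E hX hP, hb]

/-- **Stichtenoth Cor. 5.2.10 (b) at E-level: a smooth projective curve with `b₁ = 0` (`g = 0`) has closed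
points of every degree `r ≥ 1`**, under the trace formula, `χ(φ) = q` and RH («If `g = 0` then `B_r > 0`
for all `r ≥ 1`»). [cite: Stichtenoth2009, Cor. 5.2.10 (b)] -/
theorem closedPointCount_pos_of_finrank_eq_zero_of_weilRiemannHypothesis
    (hE : E.HasLefschetzTraceFormula) (hχ : ((χ (arithFrob k) : Kˣ) : K) = Nat.card k)
    (hX : IsSmoothProjective 1 X) (hRH : E.WeilRiemannHypothesisFor X 1)
    (hb : (haveI := E.finite_obj hX 1; Module.finrank K (E.obj X 1)) = 0) {r : ℕ} (hr : 0 < r) :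
    0 < closedPointCount X r := by
  haveI := locallyOfFiniteType_of_isSmoothProjective hX
  haveI : QuasiCompact X.hom := IsSmoothProjective.quasiCompact_holds hX
  obtain ⟨P, hP, hroots⟩ := hRH
  have hW := isWeilFactorization_of_isIntegralModel E hE hχ hX hP hroots
  refine Literature.NumberTheory.LFunctions.closedPointCount_pos_of_natDegree_eq_zero hW ?_ hr
  rw [natDegree_one_eq_finrank E hX hP, hb]

end Curves

end GaloisWeilCohomology

end Literature.AlgebraicGeometry.Motives

end
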